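import Summits.CriticalPhenomena.PercolationContinuityZ3.Theorems.PercNearOneGluingNoHeavyPcintBondCertZ3K6Defs
import HarnessLib

/-!
# PCINT lane, kernel check 3/8 of the B3r window certificate (`d = 3`, memory 6, `p = 0.2176`): codes `1944 ≤ n < 2916`

Cell `prim-pcint`, seat `prim-pcint-2`. The Collatz–Wielandt rows `10^5 · rowB ≤ 99995 · 2·10^72 · v` for the windows with
base-6 code in `[1944, 2916)`, by `decide +kernel` (natural-number arithmetic only; four chunks of 243 codes — larger
chunks exceed the kernel's recursion budget for these rows — hence `maxHeartbeats 0`). Does NOT build on p205010.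
-/

namespace Summit.CriticalPhenomena.PercolationContinuityZ3.Theorems.Pcint.Z3B6

set_option maxHeartbeats 0 in
/-- Rows `1944 ≤ n < 2187` of the certificate hold. [folklore] -/
theorem checkRangeB_3a : checkRangeB 1944 2187 = true := by decide +kernel

set_option maxHeartbeats 0 in
/-- Rows `2187 ≤ n < 2430` of the certificate hold. [folklore] -/
theorem checkRangeB_3b : checkRangeB 2187 2430 = true := by decide +kernel

set_option maxHeartbeats 0 in
/-- Rows `2430 ≤ n < 2673` of the certificate hold. [folklore] -/
theorem checkRangeB_3c : checkRangeB 2430 2673 = true := by decide +kernel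

set_option maxHeartbeats 0 in
/-- Rows `2673 ≤ n < 2916` of the certificate hold. [folklore] -/
theorem checkRangeB_3d : checkRangeB 2673 2916 = true := by decide +kernel

/-- Rows `1944 ≤ n < 2916` of the certificate hold. [folklore] -/
theorem checkRangeB_3 : checkRangeB 1944 2916 = true :=
  checkRangeB_of_split (checkRangeB_of_split checkRangeB_3a checkRangeB_3b) (checkRangeB_of_split checkRangeB_3c checkRangeB_3d)

end Summit.CriticalPhenomena.PercolationContinuityZ3.Theorems.Pcint.Z3B6
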